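import Summits.BirchSwinnertonDyer.Rank1Residual.Additive.LocalTrivialityUpTower
import HarnessLib

/-!
# A class whose restriction to `Γ_E` is the Kummer cocycle of a point over a finite layer is
# SIGNED — hypothesis (b) of the receptacle bridge for the descended classes (cell `b2b-bsdres`,
# CLASS-CLOSURE lane, class O10 — x1b GEN 39, class lead; file 85 of the series)

HONEST FRAMING (cell `b2b-bsdres`, run/shared/lean/b2b/bsd-rank1-residual/, verbatim in every
file): the goal of the cell is to DELETE the COMBINATION-SHAPED residual classes of the
Birch–Swinnerton-Dyer formula for ALL analytic-rank `≤ 1` elliptic curves over `ℚ` — "full BSD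
formula for every rank `≤ 1` curve in class `C`" assembled STRICTLY from published theorems — so
that the rank-`≤ 1` remainder becomes exactly the CONSTRUCTION-SHAPED classes, which are TYPED
(missing-input `Prop`s), NOT attempted. This is not "finishing BSD". CLASS-CLOSURE lane: prove
what is provable now; shrink each hard class to its core with data; no claim beyond stated classes;
research routes on CONSTRUCTION-SHAPED X12 / O10; census / instrument output = EVIDENCE / conjecture
items, NEVER a Literature fact; `RESIDUAL-MAP.md` marks change only by signed lines. THIS FILE:
TOOL THEOREMS ONLY — no definition, no named Literature fact, no `sorry`, axioms standard; nothing
is booked; no label / mark / count / sub-cell moves; (C1_η), (C2_η-GZ), (C3_η) stay typed as filed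
(cc-typer-6's pen); nothing about `BSD(W, p)` of any pair is claimed.

## What (file 73 §4 with "`res_E c = 0`" replaced by "`res_E c = [φ]`, `φ` a Kummer cocycle")

* `exists_apply_eq_add_smul_sub_of_res_eq`: `res_E [φ₀] = [φ]` ⟹ `φ₀(g|_K̄) = φ(g) + (g•T − T)` on
  `Γ_E` for some `T ∈ E[p^m]` (`map_oneCocycleClass` + `oneCocycleClass_eq_zero_iff`);
* **`resH1Hom_subgroupIncl_map_mem_localKummerOverOfEmb_of_res_eq`**: if `res_E c = [φ]` with
  `ι(φ(u)) = u•R − R` for all `u ∈ H_E` and `p^k R ∈ A` (`k ≥ m`), then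
  `res_H((E[p^m] ↪ E[p^∞])_* c) ∈ localKummerOverOfEmb W p H (closureEmb E) A` (witness point
  `R + ι(T)`);
* **`levelToLayerZero_mem_comap_iInf_localKummerOverOfEmb_of_res_eq`**: at `H = ker κ`, with `φ`
  Kummer on the layer-`n` subgroup `Gal(K̄_E/K_n·E) ⊇ Gal(K̄_E/K_∞·E)`, all `Γ_K`-conjugates:
  `Ψ_m c ∈ (⨅_σ conj_σ⁻¹ localKummerOverOfEmb W p (ker κ) (closureEmb E) A) ∘ h_0` — the signed part
  of `A₀ = Sel^{loc,∞}`.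
With `φ` one of the `p^{min(m,#S)}` descended cocycles of file 82 (`A = ⨆_n E^{−,str}(K_n·E)`,
`p^m R` a zero-clause minus point, `k = m`) this is hypothesis (b) of the receptacle bridge (file 84)
for any receptacle made of such classes: the classes produced by the elementary B3 corank engine
ARE signed. (The identification `loc_{v₀} = res_{K_{v₀}}` and the model change `K_{v₀} ⇄ E` are
files 73/76.)

References: [SerreGaloisCohomology1997] I.§2.4, I.§5.1, II.§1.1; [Kobayashi2003] Def. 1.1 / 2.1
(p. 5), §9; [GreenbergLNM1716] §2 (pp. 62–63), §3.
-/

noncomputable section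

open scoped Classical

open WeierstrassCurve Literature.NumberTheory.EllipticCurves Literature.NumberTheory.GaloisRepresentations
  NumberField IsDedekindDomain Field
open Literature.NumberTheory.EllipticCurves.Kobayashi2003
open Summit.BirchSwinnertonDyer.Rank1Residual.X11b.Levels
open Summit.BirchSwinnertonDyer.Rank1Residual.X11b
open scoped ContRepresentation

namespace Summit.BirchSwinnertonDyer.Rank1Residual.Additive.LevelBridge

universe u

section Kummer

variable {K : Type u} [Field K] (W : WeierstrassCurve K) (p : ℕ) [hp : Fact p.Prime] (m : ℕ)
  (E : Type u) [Field E] [Algebra K E]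

omit hp in
/-- A class `c ∈ H¹(K, E[p^m])` with `res_E c = [φ]` has, for any cocycle `φ₀` of `c`, a point
`T ∈ E[p^m]` with `φ₀(g|_K̄) = φ(g) + (g • T − T)` on `Γ_E`. [cite: SerreGaloisCohomology1997, I.§2.4 and I.§5.1] -/
theorem exists_apply_eq_add_smul_sub_of_res_eq
    (φ₀ : contOneCocycles
      (discreteTopRep (absoluteGaloisGroup K) (geomTorsion W ((p ^ m : ℕ) : ℤ))))
    (φ : contOneCocycles (DiscreteGaloisModule.toTopRep
      (GaloisRep.restrictField E (W.torsionGaloisModule ((p ^ m : ℕ) : ℤ)))))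
    (h : galoisCohomology.res (W.torsionGaloisModule ((p ^ m : ℕ) : ℤ)) E 1
      (oneCocycleClass _ φ₀) = oneCocycleClass _ φ) :
    ∃ T : geomTorsion W ((p ^ m : ℕ) : ℤ), ∀ σ : absoluteGaloisGroup E,
      φ₀.1 (resGal (K := K) E σ) = φ.1 σ + (resGal (K := K) E σ • T - T) := by
  unfold galoisCohomology.res galoisCohomology.pullback at h
  erw [map_oneCocycleClass] at h
  set ψ : contOneCocycles (DiscreteGaloisModule.toTopRep
      (GaloisRep.restrictField E (W.torsionGaloisModule ((p ^ m : ℕ) : ℤ)))) :=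
    contOneCocycles.pullback (absGaloisRestrict K E)
      (Y := DiscreteGaloisModule.toTopRep
        (GaloisRep.restrictField E (W.torsionGaloisModule ((p ^ m : ℕ) : ℤ))))
      (TopRep.ofHom ⟨ContinuousLinearMap.id ℤ _, fun _ => rfl⟩) φ₀ with hψ
  have h' : oneCocycleClass _ ψ = oneCocycleClass _ φ := h
  have h0 : oneCocycleClass _ (ψ - φ) = 0 := by
    rw [oneCocycleClass_sub, sub_eq_zero]
    exact h'
  obtain ⟨T, hT⟩ := (oneCocycleClass_eq_zero_iff _ _).mp h0
  refine ⟨T, fun σ ↦ ?_⟩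
  have h1 := hT σ
  change φ₀.1 (absGaloisRestrict K E σ) - φ.1 σ = absGaloisRestrict K E σ • T - T at h1
  rw [← resGal_eq_absGaloisRestrict] at h1
  rw [← h1]
  abel

omit hp in
/-- **A class whose restriction to `Γ_E` is, on `H_E = (Γ_E → Γ_K)⁻¹(H)`, the Kummer cocycle of a
point is Kummer on `H`**: if `res_E c = [φ]` with `ι(φ(u)) = u•R − R` for all `u ∈ H_E` and
`p^k R ∈ A`, then `res_H((E[p^m] ↪ E[p^∞])_* c) ∈ localKummerOverOfEmb W p H (closureEmb E) A` (the
witness point is `R + ι(T)` for the coboundary defect `T ∈ E[p^m]`). For `φ` the descended classes of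
x1b GEN 39 file 82 (`H ⊇` the layer-`n` subgroup) this is the membership of those classes in the
signed condition. [cite: Kobayashi2003, Def. 1.1 and Def. 2.1 (p. 5)] [cite: GreenbergLNM1716, §2 (pp. 62–63)] -/
theorem resH1Hom_subgroupIncl_map_mem_localKummerOverOfEmb_of_res_eq
    (H : Subgroup (absoluteGaloisGroup K)) (A : AddSubgroup (localPoints W E))
    (c : galoisCohomology (W.torsionGaloisModule ((p ^ m : ℕ) : ℤ)) 1)
    (φ : contOneCocycles (DiscreteGaloisModule.toTopRep
      (GaloisRep.restrictField E (W.torsionGaloisModule ((p ^ m : ℕ) : ℤ)))))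
    (hc : galoisCohomology.res (W.torsionGaloisModule ((p ^ m : ℕ) : ℤ)) E 1 c = oneCocycleClass _ φ)
    {R : localPoints W E} {k : ℕ} (hR : p ^ k • R ∈ A) (hkm : m ≤ k)
    (hφ : ∀ u ∈ localSubgroupOfEmb H (closureEmb (K := K) E),
      pointsMap W E ((φ.1 u : geomTorsion W ((p ^ m : ℕ) : ℤ)) : geomPoints W) = u • R - R) :
    resH1Hom (subgroupIncl H) (AddMonoidHom.id (geomPrimaryTorsion W p)) (fun _ _ ↦ rfl)
        (galoisCohomology.map (primaryInclusion W p m) 1 c) ∈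
      localKummerOverOfEmb W p H (closureEmb (K := K) E) A := by
  obtain ⟨φ₀, rfl⟩ := oneCocycleClass_surjective _ c
  obtain ⟨T, hT⟩ := exists_apply_eq_add_smul_sub_of_res_eq W p m E φ₀ φ hc
  rw [galoisCohomology.map_one_oneCocycleClass]
  erw [map_oneCocycleClass]
  set T' : localPoints W E := pointsMapOfEmb W (closureEmb (K := K) E)
    ((T : geomTorsion W _) : geomPoints W) with hT'
  refine ⟨_, R + T', k, rfl, ?_, fun τ ↦ ?_⟩
  · have h0 : p ^ k • T' = 0 := by
      obtain ⟨j, rfl⟩ := Nat.exists_eq_add_of_le hkm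
      rw [hT', ← map_nsmul, ← AddSubgroupClass.coe_nsmul, pow_add, mul_comm (p ^ m) (p ^ j),
        ← smul_smul, pow_nsmul_geomTorsion_eq_zero W p m T, smul_zero, ZeroMemClass.coe_zero, map_zero]
    rw [smul_add, h0, add_zero]
    exact hR
  · have hτ : ((φ₀.1 (resGalOfEmb (closureEmb (K := K) E) (τ : absoluteGaloisGroup E)) :
        geomTorsion W _) : geomPoints W) =
        ((φ.1 (τ : absoluteGaloisGroup E) : geomTorsion W _) : geomPoints W) +
          (resGalOfEmb (closureEmb (K := K) E) (τ : absoluteGaloisGroup E) •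
            ((T : geomTorsion W _) : geomPoints W) - ((T : geomTorsion W _) : geomPoints W)) := by
      have h := hT (τ : absoluteGaloisGroup E)
      rw [resGal_eq] at h
      rw [h, AddMemClass.coe_add, AddSubgroupClass.coe_sub,
        Literature.NumberTheory.EllipticCurves.AddSubgroup.torsionBy.coe_smul]
    change pointsMapOfEmb W (closureEmb (K := K) E)
        ((φ₀.1 (resGalOfEmb (closureEmb (K := K) E) (τ : absoluteGaloisGroup E)) :
          geomTorsion W _) : geomPoints W) = _
    rw [hτ, map_add, map_sub, pointsMapOfEmb_smul, ← hT']
    have hφτ := hφ τ τ.2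
    change pointsMapOfEmb W (closureEmb (K := K) E) _ = _ at hφτ
    rw [hφτ, smul_add]
    abel

variable (κ : ZpExtension K p)

/-- **At `H = ker κ`, all conjugates: the "signed part" of `Sel^{loc,∞}`.** If `res_E c = [φ]` with
`φ` the Kummer cocycle of `R` on the layer-`n` subgroup `Gal(K̄_E/K_n·E)` (`⊇ Gal(K̄_E/K_∞·E)`) and
`p^k R ∈ A` (`k ≥ m`), then `Ψ_m c ∈ (⨅_σ conj_σ⁻¹ localKummerOverOfEmb W p (ker κ) (closureEmb E) A)
∘ h_0` — hypothesis (b) of x1b GEN 39 file 84 for the receptacle of file 82's classes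
(`A = ⨆_n E^{−,str}(K_n·E)`, `R` a `p^m`-th root of a zero-clause minus point).
[cite: Kobayashi2003, Def. 2.1 (p. 5) and §9] -/
theorem levelToLayerZero_mem_comap_iInf_localKummerOverOfEmb_of_res_eq [NumberField K]
    (A : AddSubgroup (localPoints W E))
    (c : galoisCohomology (W.torsionGaloisModule ((p ^ m : ℕ) : ℤ)) 1)
    (φ : contOneCocycles (DiscreteGaloisModule.toTopRep
      (GaloisRep.restrictField E (W.torsionGaloisModule ((p ^ m : ℕ) : ℤ)))))
    (hc : galoisCohomology.res (W.torsionGaloisModule ((p ^ m : ℕ) : ℤ)) E 1 c = oneCocycleClass _ φ)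
    {R : localPoints W E} {k : ℕ} (hR : p ^ k • R ∈ A) (hkm : m ≤ k) (n : ℕ)
    (hφ : ∀ u ∈ localLayerSubgroupOfEmb κ (closureEmb (K := K) E) n,
      pointsMap W E ((φ.1 u : geomTorsion W ((p ^ m : ℕ) : ℤ)) : geomPoints W) = u • R - R) :
    resH1Hom (subgroupIncl (κ.layerSubgroup 0)) (AddMonoidHom.id (geomPrimaryTorsion W p))
        (fun _ _ ↦ rfl) (galoisCohomology.map (primaryInclusion W p m) 1 c) ∈
      (⨅ σ : absoluteGaloisGroup K,
        (localKummerOverOfEmb W p κ.kerSubgroup (closureEmb (K := K) E) A).comap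
          (W.conjH1 p κ.kerSubgroup σ)).comap (W.layerToInfty κ 0) := by
  rw [AddSubgroup.mem_comap, AddSubgroup.mem_iInf]
  intro σ
  rw [AddSubgroup.mem_comap, conjH1_layerToInfty_zero, layerToInfty_levelToLayerZero_eq]
  exact resH1Hom_subgroupIncl_map_mem_localKummerOverOfEmb_of_res_eq W p m E κ.kerSubgroup A c φ hc
    hR hkm (fun u hu ↦ hφ u (Subgroup.comap_mono (κ.kerSubgroup_le_layerSubgroup n) hu))

end Kummer

end Summit.BirchSwinnertonDyer.Rank1Residual.Additive.LevelBridge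

end
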